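/-
Copyright: statement-level skeleton of a published paper (lit-balaban cell, Phase-2 proof seat p19, gen 2). No claims beyond
what the kernel checks below.
-/
import Mathlib
import Literature.MathematicalPhysics.QuantumFieldTheory.Balaban1983to89.B3Ineq215Step

/-!
# B3 — T. Bałaban, *(Higgs)₂,₃ quantum fields in a finite volume. III. Renormalization*, CMP **88** (1983) 411–445
[Balaban1983Higgs3] — Sect. 2, pp. 427–428: **the estimate (2.15), PROVED** (Prop. 2.2 generality, concrete cubes)

statement-level skeleton of published theorems with citation tags; proofs where landed; nothing here is a claim about
the Yang–Mills mass gap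

PDF held: `paper:balaban1983-higgs-2-3-quantum-fields-finite-volume` (journal page = PDF page + 410); renders
`pub-balaban/b2b-balaban-ref1/pages/1983-cmp88-higgs23-III/1983-cmp88-higgs23-III-p014 … p018-x2.png` (pp. 424–428).

WHAT IS REPRODUCED.  Part of the Phase-2 proof of SKELETON rows **B3.Eq2.15-2.16** (unit `lit-balaban-p19` gen 2, HOME `run/shared/lean/pub/lit-balaban/`): files `B3Ineq215CubeGeometry` → `B3Ineq215DecaySum`, `B3Ineq215Quotient` → `B3Ineq215Degrees` → `B3Ineq215Reroute` → `B3Ineq215Step` → `B3Ineq215Proof` (the theorem `Model.ineq215`), all in the sub-namespace `…Balaban1983to89.B3Ineq215`; the rows were typed by r15 in `B3Sect2FirstEstimate`.  **(2.15)** p. 427 [PDF 17]: *"To prove the theorem it is sufficient to prove that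
Σ_{j∈J(l̃)} Σ_{{Δ(v)}} Ẽ(G(j), {Δ(v)}_{v∈G}) ≦ O(1) (2.15) with O(1) depending on n̄ and δ₁ only."* — PROVED here as
`Model.ineq215` / `Model.ineq215_of_pos`: for a generalized graph (Prop. 2.2: arbitrary η-powers `e_v` of the vertices
and dimensions `a_l` of the lines) whose lines are listed in the order l̃, IF every connected component of every
subgraph `G_i` (p. 425) has positive degree (2.2) (p. 426: *"G₁, G₂, …, G_m = G′* … have positive degrees. Thus it is
sufficient to prove the estimate (1.33) under this assumption"*), THEN for every `k` (η = L^{−k}) and every choice of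
the unit cubes `□(v)` the sum over the scale assignments `j ∈ J(l̃)` (= `Mon m k`: `0 ≤ j_{l(1)} ≤ … ≤ j_{l(m)} ≤ k − 1`,
(2.7) p. 424) and over the localizations `Δ(v) ⊂ □(v)` of size `L^{j(v)}η` of the weight (2.14) is bounded by the
EXPLICIT constant `Model.const215` (depending on the graph, `d`, `L`, `δ₀ = ½δ₁` only — not on `k` or the `□(v)`).
Proof = the printed induction: the shrinking step (2.15′)/(2.16) is `Model.step216` (`B3Ineq215Step`); here
the steps are chained for a fixed `j` (`W_zero_le`: *"Thus we have (2.16) for all i ≦ m. For i = m we get the constant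
O(1) only on the right side of (2.16)"* — `W_last`), and the summations over the indices *"Because D(G₁) > 0 we can make
the summation over j and this gives us Σ_{j=0}^{j_{l(2)}} (L^jη)^{D(G₁)} ≦ O(1)(L^{j_{l(2)}}η)^{D(G₁)}"* are performed at
the end, all at once, as the product of the `m` geometric series in the increments `j_{l(i+2)} − j_{l(i+1)}`
(`sum_prod_ratio_le`; the landed one-index form is `B3Sect2Statements.sum_scalePow_le`) — a reordering of the
printed summations, not a different argument.  The carrier `B3Sect2FirstEstimate.ScaledGraph` fixes the family of
localizations independently of `j`, whereas in (2.14)–(2.15) *"cubes Δ(v) of the size L^{j(v)}η"* depend on `j`; the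
instance of `Ineq215` on that carrier is therefore stated per assignment (see `B3Ineq215Instance`, separate file).
-/

open Finset

namespace Literature.MathematicalPhysics.QuantumFieldTheory.Balaban1983to89.B3Ineq215

namespace Model

variable {V : Type} [Fintype V] [DecidableEq V] {m : ℕ} (M : Model V m)

/-! ## The last stage: `G/G_m` is a set of points -/

/-- p. 428: *"For i = m we get the constant O(1) only on the right side of (2.16)"* — the quotient `G/G_m` has no lines,
every vertex sits at the unit scale with exactly one localization, so its weight sum is `1`.
[cite: Balaban1983Higgs3, (2.16) p.428] -/
theorem W_last (k : ℕ) (j : Fin m → ℕ) (box : V → Fin M.d → ℕ) : M.W m k j box = 1 := by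
  have hrem : remLines m m = ∅ := remLines_eq_empty le_rfl
  have hlow : ∀ b, M.low m b j k = k := fun b =>
    M.low_eq_k j k (Finset.eq_empty_of_forall_notMem fun l hl => by
      have := M.remAt_subset_remLines m b hl; rw [hrem] at this; exact Finset.notMem_empty _ this)
  have hVF : M.VF m k j = 1 := by
    unfold VF
    refine Finset.prod_eq_one fun b _ => ?_
    rw [hlow, M.sc_self, Real.one_rpow]
  have hLP : M.LP m k j = 1 := by unfold LP; rw [hrem, Finset.prod_empty]
  have hEXP : ∀ Θ, M.EXP m j Θ = 1 := fun Θ => by unfold EXP; rw [hrem, Finset.prod_empty]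
  have hloc : M.locF m k j box = fun v => {M.unit k box v} := by
    funext v
    unfold locF
    split_ifs with hv
    · rw [hlow]; exact Cube.desc_self M.L_pos _
    · rfl
  unfold W Locs
  rw [hloc, Fintype.piFinset_singleton]
  simp [hVF, hLP, hEXP]

/-! ## Chaining the steps for a fixed assignment `j` -/

/-- The lowest remaining index at stage `i`: `j_{l(i+1)}` for `i < m`, the unit scale `k` at `i = m`.
[cite: Balaban1983Higgs3, (2.16) p.428] -/
def jAt (j : Fin m → ℕ) (k i : ℕ) : ℕ := if h : i < m then j ⟨i, h⟩ else k

/-- `jAt` at a line. [cite: Balaban1983Higgs3, (2.16) p.428] -/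
theorem jAt_of_lt (j : Fin m → ℕ) (k : ℕ) {i : ℕ} (h : i < m) : jAt j k i = j ⟨i, h⟩ := dif_pos h

/-- `jAt` past the last line. [cite: Balaban1983Higgs3, (2.16) p.428] -/
theorem jAt_of_not_lt (j : Fin m → ℕ) (k : ℕ) {i : ℕ} (h : ¬ i < m) : jAt j k i = k := dif_neg h

/-- Along `J(l̃)` the lowest remaining index does not decrease. [cite: Balaban1983Higgs3, (2.7) p.424] -/
theorem jAt_le_succ {j : Fin m → ℕ} {k : ℕ} (hj : Monotone j) (hjk : ∀ l, j l < k) (i : ℕ) :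
    jAt j k i ≤ jAt j k (i + 1) := by
  unfold jAt
  split_ifs with h1 h2 h2
  · exact hj (Fin.le_iff_val_le_val.2 (Nat.le_succ i))
  · exact (hjk _).le
  · omega
  · exact le_rfl

/-- The constant of one step: `e^{δ₀} K(δ_{i+1}, d)`. [cite: Balaban1983Higgs3, (2.16) p.428] -/
noncomputable def Kst (i : ℕ) : ℝ := Real.exp M.δ₀ * Cube.Kdec (M.δAt (i + 1)) M.d

/-- `Kst > 0`. [cite: Balaban1983Higgs3, (2.16) p.428] -/
theorem Kst_pos (i : ℕ) : 0 < M.Kst i :=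
  mul_pos (Real.exp_pos _) (Cube.Kdec_pos (M.δAt_pos _) M.d_pos)

/-- The ratio of the common-ratios: `ρ_i = L^{−Σ_α D(G_{i+1}^{(α)})}`. [cite: Balaban1983Higgs3, (2.16) p.428] -/
noncomputable def rho215 (i : ℕ) : ℝ := (M.L : ℝ) ^ (-M.Dsum (i + 1))

/-- `ρ_i > 0`. [cite: Balaban1983Higgs3, (2.16) p.428] -/
theorem rho215_pos (i : ℕ) : 0 < M.rho215 i := Real.rpow_pos_of_pos M.L_pos_real _

/-- `ρ_i < 1` when `Σ_α D(G_{i+1}^{(α)}) > 0`. [cite: Balaban1983Higgs3, (2.16) p.428] -/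
theorem rho215_lt_one {i : ℕ} (hD : 0 < M.Dsum (i + 1)) : M.rho215 i < 1 :=
  Real.rpow_lt_one_of_one_lt_of_neg M.one_lt_L (by linarith)

/-- `(L^aη/L^bη)^D = ρ^{b−a}` for `a ≤ b`, `ρ = L^{−D}`. [cite: Balaban1983Higgs3, (2.16) p.428] -/
theorem sc_div_rpow (k : ℕ) {a b : ℕ} (hab : a ≤ b) (D : ℝ) :
    (M.sc k a / M.sc k b) ^ D = ((M.L : ℝ) ^ (-D)) ^ (b - a) := by
  have hL := M.L_pos_real
  have e1 : M.sc k a / M.sc k b = ((M.L : ℝ) ^ (b - a))⁻¹ := by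
    rw [← M.sc_div_sc k hab, inv_div]
  rw [e1, Real.inv_rpow (pow_nonneg hL.le _), ← Real.rpow_natCast, ← Real.rpow_mul hL.le, ← Real.rpow_neg hL.le,
    ← Real.rpow_mul_natCast hL.le]
  congr 1; ring

/-- One step in ratio form: `P_i ≤ K_i ρ_i^{n_i} P_{i+1}` with `P_i = (L^{j_{l(i+1)}}η)^{Σ_α D(G_i^{(α)})} W_i` and
`n_i = j_{l(i+2)} − j_{l(i+1)}` (`j_{l(m+1)} := k`). [cite: Balaban1983Higgs3, (2.16) p.428] -/
theorem step_ratio {i : ℕ} (h : i < m) {j : Fin m → ℕ} {k : ℕ} (hj : Monotone j) (hjk : ∀ l, j l < k)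
    (box : V → Fin M.d → ℕ) :
    M.sc k (jAt j k i) ^ M.Dsum i * M.W i k j box
      ≤ M.Kst i * M.rho215 i ^ (jAt j k (i + 1) - jAt j k i) *
        (M.sc k (jAt j k (i + 1)) ^ M.Dsum (i + 1) * M.W (i + 1) k j box) := by
  have hst := M.step216 h hj hjk box
  rw [jAt_of_lt j k h]
  refine hst.trans (le_of_eq ?_)
  have hle : j ⟨i, h⟩ ≤ jAt j k (i + 1) := by
    have := jAt_le_succ hj hjk i; rwa [jAt_of_lt j k h] at this
  have hx := M.sc_pos k (j ⟨i, h⟩)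
  have hy := M.sc_pos k (jAt j k (i + 1))
  have e : M.sc k (j ⟨i, h⟩) ^ M.Dsum (i + 1)
      = (M.sc k (j ⟨i, h⟩) / M.sc k (jAt j k (i + 1))) ^ M.Dsum (i + 1) * M.sc k (jAt j k (i + 1)) ^ M.Dsum (i + 1) := by
    rw [Real.div_rpow hx.le hy.le, div_mul_cancel₀ _ (Real.rpow_pos_of_pos hy _).ne']
  unfold Kst rho215
  rw [e, M.sc_div_rpow k hle]
  ring

/-- p. 428: *"We can prove (2.16) for i+1 repeating the same reasoning … Thus we have (2.16) for all i ≦ m. For i = m we get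
the constant O(1) only on the right side"* — chaining `step_ratio` from `0` to `m` and using `W_last`:
`Σ_{{Δ}} Ẽ(G(j), {Δ}) ≤ Π_{i<m} K_i ρ_i^{n_i(j)}`. [cite: Balaban1983Higgs3, (2.16) p.428] -/
theorem W_zero_le {j : Fin m → ℕ} {k : ℕ} (hj : Monotone j) (hjk : ∀ l, j l < k) (box : V → Fin M.d → ℕ) :
    M.W 0 k j box ≤ ∏ i ∈ Finset.range m, (M.Kst i * M.rho215 i ^ (jAt j k (i + 1) - jAt j k i)) := by
  -- P n := sc^{Dsum n} W n;  P 0 ≤ (∏_{i<n} c_i) P n for n ≤ m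
  have chain : ∀ n, n ≤ m → M.sc k (jAt j k 0) ^ M.Dsum 0 * M.W 0 k j box
      ≤ (∏ i ∈ Finset.range n, (M.Kst i * M.rho215 i ^ (jAt j k (i + 1) - jAt j k i))) *
        (M.sc k (jAt j k n) ^ M.Dsum n * M.W n k j box) := by
    intro n hn
    induction n with
    | zero => simp
    | succ n ih =>
        have hn' : n < m := Nat.lt_of_succ_le hn
        refine (ih hn'.le).trans ?_
        rw [Finset.prod_range_succ, mul_assoc]
        refine mul_le_mul_of_nonneg_left (M.step_ratio hn' hj hjk box) ?_
        exact Finset.prod_nonneg fun i _ => mul_nonneg (M.Kst_pos i).le (pow_nonneg (M.rho215_pos i).le _)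
  have h0 : M.sc k (jAt j k 0) ^ M.Dsum 0 * M.W 0 k j box = M.W 0 k j box := by
    rw [M.Dsum_zero, Real.rpow_zero, one_mul]
  have hm : M.sc k (jAt j k m) ^ M.Dsum m * M.W m k j box = 1 := by
    rw [jAt_of_not_lt j k (lt_irrefl m), M.sc_self, Real.one_rpow, M.W_last, mul_one]
  have := chain m le_rfl
  rwa [h0, hm, mul_one] at this

/-! ## The summation over the scale assignments `j ∈ J(l̃)` -/

/-- `J(l̃)` of (2.7) p. 424 for the lines listed in the order l̃: the assignments `0 ≤ j_{l(1)} ≤ … ≤ j_{l(m)} ≤ k − 1`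
(monotone along the order; cf. `B3.OrderedAlong` for an arbitrary ordering, here the identity).
[cite: Balaban1983Higgs3, (2.7) p.424] -/
noncomputable def Mon (m k : ℕ) : Finset (Fin m → ℕ) := by
  classical exact (Fintype.piFinset fun _ : Fin m => Finset.range k).filter fun j => Monotone j

/-- Membership in `J(l̃)`. [cite: Balaban1983Higgs3, (2.7) p.424] -/
theorem mem_Mon {m k : ℕ} {j : Fin m → ℕ} : j ∈ Mon m k ↔ Monotone j ∧ ∀ l, j l < k := by
  classical
  unfold Mon
  rw [Finset.mem_filter, Fintype.mem_piFinset]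
  simp only [Finset.mem_range]
  tauto

/-- The increments `n_i(j) = j_{l(i+2)} − j_{l(i+1)}` (`j_{l(m+1)} := k`) determine `j ∈ J(l̃)`.
[cite: Balaban1983Higgs3, (2.7) p.424] -/
theorem injOn_increments (m k : ℕ) :
    Set.InjOn (fun (j : Fin m → ℕ) (i : Fin m) => jAt j k (i + 1) - jAt j k i) ↑(Mon m k) := by
  intro j hj j' hj' hinc
  rw [Finset.mem_coe, mem_Mon] at hj hj'
  -- downward induction: jAt j (m - r) = jAt j' (m - r)
  have key : ∀ r, r ≤ m → jAt j k (m - r) = jAt j' k (m - r) := by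
    intro r hr
    induction r with
    | zero => rw [Nat.sub_zero, jAt_of_not_lt j k (lt_irrefl m), jAt_of_not_lt j' k (lt_irrefl m)]
    | succ r ih =>
        have hi : m - (r + 1) < m := by omega
        have e := congrFun hinc ⟨m - (r + 1), hi⟩
        simp only at e
        have hsucc : m - (r + 1) + 1 = m - r := by omega
        rw [hsucc] at e
        have h1 := jAt_le_succ hj.1 hj.2 (m - (r + 1))
        have h2 := jAt_le_succ hj'.1 hj'.2 (m - (r + 1))
        rw [hsucc] at h1 h2
        have := ih (by omega)
        omega
  funext l
  have := key (m - (l : ℕ)) (by omega)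
  have e : m - (m - (l : ℕ)) = l := by have := l.isLt; omega
  rw [e, jAt_of_lt j k l.isLt, jAt_of_lt j' k l.isLt] at this
  exact this

/-- Each increment is at most `k`. [cite: Balaban1983Higgs3, (2.7) p.424] -/
theorem increment_le {m k : ℕ} {j : Fin m → ℕ} (hj : j ∈ Mon m k) (i : Fin m) :
    jAt j k (i + 1) - jAt j k i ≤ k := by
  rw [mem_Mon] at hj
  have : jAt j k (i + 1) ≤ k := by
    unfold jAt; split_ifs with h
    · exact (hj.2 _).le
    · exact le_rfl
  omega

/-- p. 427–428: *"Because D(G₁) > 0 we can make the summation over j … ≦ O(1)(L^{j_{l(2)}}η)^{D(G₁)}"*, all `m` summations at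
once: for ratios `0 ≤ ρ_i < 1`, `Σ_{j∈J(l̃)} Π_i ρ_i^{n_i(j)} ≤ Π_i (1 − ρ_i)^{−1}` (substitute the increments, which
determine `j`, and sum the `m` independent geometric series). [cite: Balaban1983Higgs3, (2.16) p.428] -/
theorem sum_prod_ratio_le (m k : ℕ) (ρ : ℕ → ℝ) (h0 : ∀ i, 0 ≤ ρ i) (h1 : ∀ i, ρ i < 1) :
    ∑ j ∈ Mon m k, ∏ i ∈ Finset.range m, ρ i ^ (jAt j k (i + 1) - jAt j k i)
      ≤ ∏ i ∈ Finset.range m, (1 - ρ i)⁻¹ := by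
  classical
  set nOf : (Fin m → ℕ) → (Fin m → ℕ) := fun j i => jAt j k (i + 1) - jAt j k i with hnOf
  set g : (Fin m → ℕ) → ℝ := fun n => ∏ i : Fin m, ρ i ^ n i with hg
  have hg0 : ∀ n, 0 ≤ g n := fun n => Finset.prod_nonneg fun i _ => pow_nonneg (h0 i) _
  -- rewrite the summand as g (nOf j)
  have e1 : ∀ j, ∏ i ∈ Finset.range m, ρ i ^ (jAt j k (i + 1) - jAt j k i) = g (nOf j) := by
    intro j
    rw [hg, hnOf]
    exact (Fin.prod_univ_eq_prod_range (fun i => ρ i ^ (jAt j k (i + 1) - jAt j k i)) m).symm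
  simp_rw [e1]
  -- injective substitution, then enlarge to the box
  rw [← Finset.sum_image (injOn_increments m k)]
  have hsub : (Mon m k).image nOf ⊆ Fintype.piFinset fun _ : Fin m => Finset.range (k + 1) := by
    intro n hn
    obtain ⟨j, hj, rfl⟩ := Finset.mem_image.1 hn
    exact Fintype.mem_piFinset.2 fun i => Finset.mem_range.2 (Nat.lt_succ_of_le (increment_le hj i))
  refine (Finset.sum_le_sum_of_subset_of_nonneg hsub fun n _ _ => hg0 n).trans ?_
  rw [hg, ← Finset.prod_univ_sum (t := fun _ : Fin m => Finset.range (k + 1)) (f := fun i n => ρ i ^ n),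
    Fin.prod_univ_eq_prod_range (fun i => ∑ n ∈ Finset.range (k + 1), ρ i ^ n) m]
  refine Finset.prod_le_prod (fun i _ => Finset.sum_nonneg fun n _ => pow_nonneg (h0 i) _) fun i _ => ?_
  have hs : Summable fun n : ℕ => ρ i ^ n := summable_geometric_of_lt_one (h0 i) (h1 i)
  rw [← tsum_geometric_of_lt_one (h0 i) (h1 i)]
  exact hs.sum_le_tsum _ fun n _ => pow_nonneg (h0 i) n

/-! ## (2.15) -/

/-- The constant `O(1)` of (2.15), explicit: `Π_{i<m} e^{δ₀}K(δ_{i+1}, d) · Π_{i<m} (1 − L^{−Σ_α D(G_{i+1}^{(α)})})^{−1}` —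
depends on the graph, `d`, `L` and `δ₀ = ½δ₁` only (*"O(1) depending on n̄ and δ₁ only"*), not on `k`, `η`, or the unit
cubes `□(v)`. [cite: Balaban1983Higgs3, (2.15) p.427] -/
noncomputable def const215 : ℝ := (∏ i ∈ Finset.range m, M.Kst i) * ∏ i ∈ Finset.range m, (1 - M.rho215 i)⁻¹

/-- **(2.15)** p. 427 [PDF 17], PROVED (Prop. 2.2 generality; concrete cubes; sum-of-degrees form of the hypothesis):
if `Σ_α D(G_i^{(α)}) > 0` for `i = 1, …, m`, then for every `k` (η = L^{−k}) and all unit cubes `□(v)`,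
`Σ_{j∈J(l̃)} Σ_{{Δ(v)}} Ẽ(G(j), {Δ(v)}) ≤ const215`. [cite: Balaban1983Higgs3, (2.15) p.427] -/
theorem ineq215 (hD : ∀ i, i < m → 0 < M.Dsum (i + 1)) (k : ℕ) (box : V → Fin M.d → ℕ) :
    ∑ j ∈ Mon m k, M.W 0 k j box ≤ M.const215 := by
  have hρ0 : ∀ i, 0 ≤ M.rho215 i := fun i => (M.rho215_pos i).le
  -- ratios clipped to make them < 1 also for i ≥ m (where they do not matter)
  set ρ : ℕ → ℝ := fun i => if i < m then M.rho215 i else 0 with hρ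
  have hρ0' : ∀ i, 0 ≤ ρ i := fun i => by simp only [hρ]; split_ifs <;> [exact hρ0 i; exact le_rfl]
  have hρ1' : ∀ i, ρ i < 1 := fun i => by
    simp only [hρ]; split_ifs with h <;> [exact M.rho215_lt_one (hD i h); exact one_pos]
  have hρeq : ∀ i ∈ Finset.range m, ρ i = M.rho215 i := fun i hi => by
    simp only [hρ]; simp [Finset.mem_range.1 hi]
  calc ∑ j ∈ Mon m k, M.W 0 k j box
      ≤ ∑ j ∈ Mon m k, ∏ i ∈ Finset.range m, (M.Kst i * M.rho215 i ^ (jAt j k (i + 1) - jAt j k i)) :=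
        Finset.sum_le_sum fun j hj => M.W_zero_le (mem_Mon.1 hj).1 (mem_Mon.1 hj).2 box
    _ = (∏ i ∈ Finset.range m, M.Kst i) *
          ∑ j ∈ Mon m k, ∏ i ∈ Finset.range m, ρ i ^ (jAt j k (i + 1) - jAt j k i) := by
        rw [Finset.mul_sum]
        refine Finset.sum_congr rfl fun j _ => ?_
        rw [Finset.prod_mul_distrib]
        congr 1
        exact Finset.prod_congr rfl fun i hi => by rw [hρeq i hi]
    _ ≤ (∏ i ∈ Finset.range m, M.Kst i) * ∏ i ∈ Finset.range m, (1 - ρ i)⁻¹ :=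
        mul_le_mul_of_nonneg_left (sum_prod_ratio_le m k ρ hρ0' hρ1')
          (Finset.prod_nonneg fun i _ => (M.Kst_pos i).le)
    _ = M.const215 := by
        unfold const215
        congr 1
        exact Finset.prod_congr rfl fun i hi => by rw [hρeq i hi]

/-- **(2.15)** with the hypothesis as printed (p. 426: the subgraphs `G₁, …, G_m` *"have positive degrees"*, i.e. every
connected component of every `G_i` has `D > 0`): then `Σ_{j∈J(l̃)} Σ_{{Δ(v)}} Ẽ(G(j), {Δ(v)}) ≤ const215` for every `k` and
all unit cubes. [cite: Balaban1983Higgs3, (2.15) p.427] -/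
theorem ineq215_of_pos (hpos : ∀ i, i ≤ m → ∀ b ∈ M.reps i, M.Nontriv i b → 0 < M.D i b) (k : ℕ)
    (box : V → Fin M.d → ℕ) : ∑ j ∈ Mon m k, M.W 0 k j box ≤ M.const215 :=
  M.ineq215 (fun i hi => M.Dsum_succ_pos hi (hpos (i + 1) hi)) k box

/-- The constant is positive (sanity: the bound is non-vacuous in sign). [cite: Balaban1983Higgs3, (2.15) p.427] -/
theorem const215_pos (hD : ∀ i, i < m → 0 < M.Dsum (i + 1)) : 0 < M.const215 := by
  unfold const215
  refine mul_pos (Finset.prod_pos fun i _ => M.Kst_pos i) (Finset.prod_pos fun i hi => ?_)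
  have := M.rho215_lt_one (hD i (Finset.mem_range.1 hi))
  exact inv_pos.2 (by linarith)

end Model

end Literature.MathematicalPhysics.QuantumFieldTheory.Balaban1983to89.B3Ineq215
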